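import Summits.ResolutionOfSingularities.ResolutionOfSingularities.Theorems.MarkedTransferCampaignW46ThreefoldsGammaFreeGlobalFamily
import Summits.ResolutionOfSingularities.ResolutionOfSingularities.Theorems.MarkedTransferCampaignW46ThreefoldsGammaFreeGlobalStrictTransform
import Literature.AlgebraicGeometry.Resolution.QuasiExcellentBlowup
import HarnessLib

/-!
# [OURS · L1 W4.6 rung (ii), dimension ladder] THE PRIME-DIVISOR FAMILY AFTER ONE POINT BLOW-UP: strict transforms plus the
# exceptional curve, with the `δ`-bookkeeping (brick B10b-fam of rung (ii-2) `GammaFreeGlobalOrderReductionDimLE p 2`)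

Cell res-hironaka, LADDER-RESOLUTION rung L (D-0089), slot W4.6, rung (ii) (dimension ladder, res-L1-type-o1 p496755); seat
res-D-pv-049 AS res-L1-s46-pv-11 (holder of rung (ii-2); architecture v2, STATUS 2026-08-27T05:4xZ). Host route MarkedTransfer, host
item `HypersurfaceOrderReductionDimLeThree` (stmt-ResolutionOfSingularities-16156); proposed `--kind proof --supports` it `--as helper`.
Everything here is OURS scheme theory over the tree's library; nothing of H. Hironaka's manuscript [Hironaka2017] is asserted.
AI-written; AI review is weaker than expert review.

## What is proved

`CampaignW46.exists_family_pointBlowup` — the STATE TRANSITION of the surface loop at the level of prime-divisor families. Input: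
a regular integral Noetherian quasi-excellent `X` of dimension `≤ 2`, a closed point `x` (not a codimension-one point of `V(J)`),
a blowing up `π : X′ → X` along `𝓘_{x}`, `J ≠ 0`, `m`, and a family `(ζ_k, i_k : C_k ↪ X)_{k ∈ ι}` of integral Noetherian
quasi-excellent curves presenting the prime divisors of `V(J)` (brick B10a `exists_primeDivisorFamily`). Output: a family for the
controlled transform `J′ = (J𝒪_{X′} : 𝓘_E^m)` indexed by `ι ⊕ PLift (m < ord_x J)` — the strict transforms `j_k : C₁,k ↪ X′`
(brick B8b) and, when `m < ord_x J`, the exceptional curve `E = cl{η_E} ↪ X′` (brick B8a) — presenting EXACTLY the prime divisors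
of `V(J′)`, together with the `δ`-bookkeeping: `Σδ(C₁,k) ≤ Σδ(C_k)` for every `k`, strictly for a `k` whose curve is singular at a
point over `x`, and `Σδ(E) = 0` (`E` is regular). Summing over the family (next brick) gives the drop of the first component `Δ` of
the termination measure `(Δ, Σ(i−1), Σ(k−2)⁺)`.

## Sources

* Q. Liu, *Algebraic Geometry and Arithmetic Curves* (2002), §9.2.4 Lemma 2.32, Thm. 8.1.19. [Liu2002]
* J. Kollár, *Lectures on Resolution of Singularities* (2007), §1.4. [Kollar2007]
* The Stacks Project, Tags 02OS, 0BE1, 07QU. [StacksProject]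
* H. Hironaka, ms. 2017-03-23, Def. 2.1 p.5 — scope only, under adjudication, not cited as fact. [Hironaka2017]
-/

noncomputable section

set_option linter.dupNamespace false -- mandated namespace of this single-conjunct summit

open CategoryTheory AlgebraicGeometry TopologicalSpace IsLocalRing Topology

namespace Summit.ResolutionOfSingularities.ResolutionOfSingularities.Theorems

namespace CampaignW46

open Literature.AlgebraicGeometry.Resolution
open Scheme.IdealSheafData

universe u

/-- The reduced closed subscheme on a proper closed irreducible subset `cl{η}` of an integral Noetherian scheme of dimension
`≤ 2` has dimension `≤ 1`. [folklore] -/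
theorem topologicalKrullDim_subscheme_primeDivisorIdeal_le_one {Y : Scheme.{u}} [IsIntegral Y] [IsNoetherian Y]
    (hdim : topologicalKrullDim Y ≤ 2) {η : Y} (hne : closure ({η} : Set Y) ≠ Set.univ) :
    topologicalKrullDim (primeDivisorIdeal η).subscheme ≤ 1 := by
  have hW : IsClosed (closure ({η} : Set Y)) := isClosed_closure
  have hlt : topologicalKrullDim (closure ({η} : Set Y)) < ((2 : ℕ) : WithBot ℕ∞) :=
    Literature.Topology.topologicalKrullDim_lt_of_isClosed_ssubset hW hne 2
      (lt_of_le_of_lt hdim (by exact_mod_cast WithBot.coe_lt_coe.mpr (by decide)))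
  have hle : topologicalKrullDim (closure ({η} : Set Y)) ≤ (1 : ℕ) := by
    rw [show ((2 : ℕ) : WithBot ℕ∞) = ((1 : ℕ) : WithBot ℕ∞) + 1 by norm_num] at hlt
    exact ENat.WithBot.lt_add_one_iff.mp hlt
  set i := (primeDivisorIdeal η).subschemeι
  have hrange : ∀ c, i c ∈ closure ({η} : Set Y) := fun c => by
    have : i c ∈ Set.range i := ⟨c, rfl⟩
    rwa [Scheme.IdealSheafData.range_subschemeι, coe_support_primeDivisorIdeal] at this
  have hind : IsInducing (Set.codRestrict i (closure ({η} : Set Y)) hrange) :=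
    i.isClosedEmbedding.isInducing.codRestrict hrange
  exact hind.topologicalKrullDim_le.trans (by exact_mod_cast hle)

/-- **[OURS · W4.6 rung (ii-2), brick B10b-fam] The prime-divisor family after one point blow-up.** See the module docstring.
[cite: Liu2002, §9.2.4 Lemma 2.32] [cite: StacksProject, Tag 02OS] -/
theorem exists_family_pointBlowup {X X' : Scheme.{u}} [IsIntegral X] [IsNoetherian X] (hX : Scheme.IsRegular X)
    (hXq : Scheme.IsQuasiExcellent X) (hdim : topologicalKrullDim X ≤ 2) {x : X} (hx : IsClosed ({x} : Set X))
    (hxne : ({x} : Set X) ≠ Set.univ) {π : X' ⟶ X} (hπ : IsBlowup π (vanishingIdeal ⟨{x}, hx⟩))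
    (J : X.IdealSheafData) (m : ℕ) (hxJ : x ∉ divisorialPoints J)
    {ι : Type} (ζ : ι → X) (C : ι → Scheme.{u}) (i : ∀ k, C k ⟶ X) (hζinj : Function.Injective ζ)
    (hζrange : Set.range ζ = divisorialPoints J)
    (hfam : ∀ k, IsClosedImmersion (i k) ∧ ∃ (_ : IsIntegral (C k)) (_ : IsNoetherian (C k)),
      Scheme.IsQuasiExcellent (C k) ∧ topologicalKrullDim (C k) ≤ 1 ∧ i k (genericPoint (C k)) = ζ k) :
    ∃ (ζ' : ι ⊕ PLift ((m : ℕ∞) < idealOrder J x) → X') (C' : ι ⊕ PLift ((m : ℕ∞) < idealOrder J x) → Scheme.{u})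
      (i' : ∀ k', C' k' ⟶ X'),
      Function.Injective ζ' ∧ Set.range ζ' = divisorialPoints (controlledTransform π (vanishingIdeal ⟨{x}, hx⟩) J m) ∧
      (∀ k', IsClosedImmersion (i' k') ∧ ∃ (_ : IsIntegral (C' k')) (_ : IsNoetherian (C' k')),
        Scheme.IsQuasiExcellent (C' k') ∧ topologicalKrullDim (C' k') ≤ 1 ∧ i' k' (genericPoint (C' k')) = ζ' k') ∧
      (∀ k, π (ζ' (Sum.inl k)) = ζ k) ∧ (∀ s, π (ζ' (Sum.inr s)) = x) ∧
      (∀ k, ∀ (_ : IsIntegral (C' (Sum.inl k))) (_ : IsIntegral (C k)),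
        ∑ᶠ y, pointDelta (C' (Sum.inl k)) y ≤ ∑ᶠ y, pointDelta (C k) y ∧
        ((∃ c : C k, i k c = x ∧ c ∉ Scheme.regularLocus (C k)) →
          ∑ᶠ y, pointDelta (C' (Sum.inl k)) y < ∑ᶠ y, pointDelta (C k) y)) ∧
      (∀ s, ∀ (_ : IsIntegral (C' (Sum.inr s))), ∑ᶠ y, pointDelta (C' (Sum.inr s)) y = 0) := by
  classical
  haveI : IsLocallyNoetherian X := inferInstance
  haveI : IsIntegral X' := hπ.isIntegral (vanishingIdeal_singleton_ne_bot hx hxne)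
  haveI : IsProper π := hπ.isProper
  haveI : IsLocallyNoetherian X' := LocallyOfFiniteType.isLocallyNoetherian π
  haveI : CompactSpace X' := QuasiCompact.compactSpace_of_compactSpace π
  haveI : IsNoetherian X' := {}
  have hXq' : Scheme.IsQuasiExcellent X' := hπ.isQuasiExcellent hXq
  have hdim' : topologicalKrullDim X' ≤ 2 := hπ.topologicalKrullDim_le hdim
  -- the exceptional generic point
  obtain ⟨η, hη⟩ := exists_isGenericPoint_exc hX hx hxne hπ
  have hηx : π η = x := apply_excGen_eq hη
  have hgx : genericPoint X ≠ x := fun h' => hxne (by rw [← hx.closure_eq, ← h', genericPoint_closure])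
  have hEne : closure ({η} : Set X') ≠ Set.univ := by
    intro h
    obtain ⟨z, hz⟩ := exists_eq_of_ne_centre hx hπ hgx
    have hzE : z ∈ closure ({η} : Set X') := h ▸ Set.mem_univ z
    rw [hη] at hzE
    exact hgx (hz.symm.trans hzE)
  -- the strict transforms, member by member (brick B8b)
  have hζx : ∀ k, ζ k ≠ x := fun k h => hxJ (h ▸ (hζrange ▸ ⟨k, rfl⟩ : ζ k ∈ divisorialPoints J))
  have step : ∀ k, ∃ (C₁ : Scheme.{u}) (j : C₁ ⟶ X') (ρ : C₁ ⟶ C k), IsClosedImmersion j ∧ j ≫ π = ρ ≫ i k ∧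
      ∃ (_ : IsIntegral C₁) (_ : IsNoetherian C₁), Scheme.IsQuasiExcellent C₁ ∧ topologicalKrullDim C₁ ≤ 1 ∧
      ∃ (hCk : IsIntegral (C k)), π (j (genericPoint C₁)) = ζ k ∧
      ∑ᶠ y, pointDelta C₁ y ≤ ∑ᶠ y, pointDelta (C k) y ∧
      ((∃ c : C k, i k c = x ∧ c ∉ Scheme.regularLocus (C k)) → ∑ᶠ y, pointDelta C₁ y < ∑ᶠ y, pointDelta (C k) y) := by
    intro k
    obtain ⟨hci, hint, hN, hq, hd, hgen⟩ := hfam k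
    haveI := hci; haveI := hint; haveI := hN
    obtain ⟨C₁, j, ρ, hj, hsq, hint₁, hN₁, hq₁, hd₁, -, -, hgen₁, -, hle, hlt⟩ :=
      exists_strictTransform_pointBlowup (i k) hq hd hx (by rw [hgen]; exact hζx k) hπ
    exact ⟨C₁, j, ρ, hj, hsq, hint₁, hN₁, hq₁, hd₁, hint, by rw [hgen₁, hgen], hle, hlt⟩
  choose C₁ j ρ hj hsq hint₁ hN₁ hq₁ hd₁ hintC hgen₁ hle hlt using step
  -- the new family
  let σ := PLift ((m : ℕ∞) < idealOrder J x)
  let C' : ι ⊕ σ → Scheme.{u} := fun k' => Sum.rec (fun k => C₁ k) (fun _ => (primeDivisorIdeal η).subscheme) k'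
  let i' : ∀ k', C' k' ⟶ X' := fun k' => match k' with
    | Sum.inl k => j k
    | Sum.inr _ => (primeDivisorIdeal η).subschemeι
  let ζ' : ι ⊕ σ → X' := fun k' => match k' with
    | Sum.inl k => j k (genericPoint (C₁ k))
    | Sum.inr _ => η
  have hζ'inl : ∀ k, π (ζ' (Sum.inl k)) = ζ k := fun k => hgen₁ k
  have hζ'inl_ne : ∀ k, π (ζ' (Sum.inl k)) ≠ x := fun k => by rw [hζ'inl]; exact hζx k
  refine ⟨ζ', C', i', ?_, ?_, ?_, hζ'inl, fun _ => hηx, fun k _ _ => ⟨hle k, hlt k⟩, fun s _ => ?_⟩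
  · -- injectivity
    rintro (k | s) (l | t) h
    · have h1 : π (ζ' (Sum.inl k)) = π (ζ' (Sum.inl l)) := by rw [h]
      rw [hζ'inl, hζ'inl] at h1
      rw [hζinj h1]
    · exact absurd (h ▸ hζ'inl_ne k : π (ζ' (Sum.inr t)) ≠ x) (by simp [ζ', hηx])
    · exact absurd (h ▸ hζ'inl_ne l : π (ζ' (Sum.inr s)) ≠ x) (by simp [ζ', hηx])
    · rcases s with ⟨s⟩; rcases t with ⟨t⟩; rfl
  · -- the images are exactly the prime divisors of `J′`
    ext ξ'
    constructor
    · rintro ⟨k' | s, rfl⟩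
      · rw [mem_divisorialPoints_controlledTransform_iff_of_ne hx hπ (hζ'inl_ne k') J m, hζ'inl, ← hζrange]
        exact ⟨k', rfl⟩
      · exact (excGen_mem_divisorialPoints_iff hX hx hxne hπ hη J m).mpr s.down
    · intro hξ'
      by_cases hξ'x : π ξ' = x
      · have heq := eq_excGen_of_mem_divisorialPoints hX hx hxne hπ hη hξ'x hξ'
        subst heq
        exact ⟨Sum.inr ⟨(excGen_mem_divisorialPoints_iff hX hx hxne hπ hη J m).mp hξ'⟩, rfl⟩
      · have hmem : π ξ' ∈ divisorialPoints J :=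
          (mem_divisorialPoints_controlledTransform_iff_of_ne hx hπ hξ'x J m).mp hξ'
        rw [← hζrange] at hmem
        obtain ⟨k, hk⟩ := hmem
        refine ⟨Sum.inl k, eq_of_apply_eq_of_ne_centre hx hπ (hζ'inl_ne k) ?_⟩
        rw [hζ'inl, hk]
  · -- member properties
    rintro (k | s)
    · exact ⟨hj k, hint₁ k, hN₁ k, hq₁ k, hd₁ k, rfl⟩
    · haveI hE : IsIntegral (primeDivisorIdeal η).subscheme :=
        isIntegral_subscheme_vanishingIdeal _ isIrreducible_singleton.closure
      haveI : IsLocallyNoetherian (primeDivisorIdeal η).subscheme :=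
        LocallyOfFiniteType.isLocallyNoetherian (primeDivisorIdeal η).subschemeι
      haveI : CompactSpace (primeDivisorIdeal η).subscheme :=
        QuasiCompact.compactSpace_of_compactSpace (primeDivisorIdeal η).subschemeι
      haveI hNE : IsNoetherian (primeDivisorIdeal η).subscheme := {}
      exact ⟨inferInstance, hE, hNE,
        Scheme.IsQuasiExcellent.of_isClosedImmersion (primeDivisorIdeal η).subschemeι hXq',
        topologicalKrullDim_subscheme_primeDivisorIdeal_le_one hdim' hEne, subschemeι_genericPoint_primeDivisorIdeal η⟩
  · -- `Σδ(E) = 0`: the exceptional curve is regular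
    have hreg : Scheme.IsRegular (primeDivisorIdeal η).subscheme := isRegular_subscheme_primeDivisorIdeal_excGen hX hx hπ hη
    have hdE := topologicalKrullDim_subscheme_primeDivisorIdeal_le_one hdim' hEne
    refine finsum_eq_zero_of_forall_eq_zero fun y => ?_
    exact pointDelta_eq_zero_of_isRegularLocalRing hdE y (hreg y)

end CampaignW46

end Summit.ResolutionOfSingularities.ResolutionOfSingularities.Theorems

end
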